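import Summits.QuantumFields.BalabanUV.T4Continuum.Support.LineAveragingTwoLevel

/-!
# T⁴ programme, spine node NE2 (U1a), sub-row Δ1 «NE2⁰-Dirichlet» — THE SECOND PLANTED PAIRING IDENTITY: Bałaban's `n`-fold line-sum
# average of King's `L`-block means IS the `(Ln)`-fold line-sum average up to an operator-norm defect of relative size `n⁻¹`:
# `Q_n·Qavg_L = Q_{Ln} + D_E`, `‖D_E‖ ≤ 2·n⁻¹·(√((Ln)^d))⁻¹`

NE2 formalisation swarm `b2b-balaban-t4-ne2-formalise-*`, LEAF PROVER 07 (gen 8), owner item O14-b′ «W3-BOX-COMPRESSED», piece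
**(P-mass)** «W3-MASS-PAIRING» (journal 2026-08-20 l.20983 / l.21413; owner rulings R33/R34 l.20956 / l.21267), file 2 of 4.  The tree's
first pairing identity `LineAveragingPairing.sqrt_smul_QvOp_mul_JK` (row B3.a′) handles `Q_{Ln}·J_L`; the two-level commutator of the
mass term `a n^d·Q_nᴴQ_n` ALSO needs `J_L·Q_nᴴ = √(L^d)·(Q_n·Qavg_L)ᴴ`, i.e. how the (1.18) tent of fineness `n` averages King's
`L`-block means.  THIS FILE proves, with no tent weights and no Fourier analysis:

 * §1 `lineSum_Qavg_mulVec` / `sum_lineSum_fine`: both sides, coarse cell by coarse cell, as contour sums over the SAME fine points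
   `cpt(ny + j) + off(r[μ ↦ 0]) + m·e′_μ` — strided (`m = r_μ + Lt`) resp. full (`m = r_μ + t′`);
 * §2 **`twoLevel_defect_apply`** (pointwise): `((Q_n·Qavg_L − Q_{Ln})g)(y,μ) = −(Ln)^{−(d+1)}·L⁻¹·Σ_{j,r,σ<L} [Σ_{i<σ} g(far end + i)
   − Σ_{i<σ} g(near end + i)]` by file 1's `two_level_cancellation`; `norm_twoLevel_defect_apply_le`: its size is
   `L·(Ln)^{−(d+1)}·(S(y + e_μ) + S(y))` with `S` the `ℓ¹`-mass of `g(·,μ)` on a unit block (the fibre count `sum_sum_update`);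
 * §3 **`opNorm_QvOp_mul_Qavg_sub_le : ‖Q_n·Qavg_L − Q_{Ln}‖ ≤ 2·n⁻¹·(√((Ln)^d))⁻¹`** (Cauchy–Schwarz over the two blocks, tilings).

HONEST FRAMING (T4-DAG p. 1).  `U = 1`; finite torus; Bałaban's line-sum averaging (1.18) and King's block averaging /
planting (2.10) as the tree types them; exact lattice identities and Cauchy–Schwarz only — no Fourier analysis, no regularity of any
field; statements, pairings and constants OURS ([folklore]; the `[cite:]` tags locate the printed OBJECTS, Bałaban and King print no
such two-level identity); ONE summand (the mass term) of ONE displayed binder (W3, King's compressed injected law) of the cell's NE2 crux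
is served; W3 on boxes OPEN; Δ1 NOT closed; NE2 (U1a) NOT proved; spine PROVED 0/9 unchanged; NOT [B9] (3.16)/(3.23)–(3.27) as printed;
NOT infinite volume, NOT a mass gap, NOT the Clay problem, NOT summit progress.  HONEST DEPENDENCY: continuum YM on T⁴ ⇐ BetaPertH ∧ nine
spine estimates (0/9 proved); BetaPertH ⇐ (D1) ∧ (D4) ∧ CAP+tail; G-an2-4 gates asym, D1 and NE2/3/4.  No `sorry`.
-/

noncomputable section

open scoped BigOperators ComplexConjugate Matrix Matrix.Norms.L2Operator
open Finset

namespace Summit.QuantumFields.BalabanUV.T4Continuum.LineAveragingTwoLevelPairing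

open Literature.MathematicalPhysics.QuantumFieldTheory.Balaban1983to89.B5Prop11Plancherel (Tor fine unitVec)
open Literature.MathematicalPhysics.QuantumFieldTheory.Balaban1983to89.B5Prop11Lower (nsq nsq_nonneg)
open Literature.MathematicalPhysics.QuantumFieldTheory.Balaban1983to89.B5Block118 (bpt tstep tstep_zero tstep_succ lineSum
  QvOp QvOp_mulVec bpt_add_tstep)
open Literature.MathematicalPhysics.QuantumFieldTheory.Balaban1983to89.B5Blocks16 (blockOf bpt_val bpt_bijective)
open Literature.MathematicalPhysics.QuantumFieldTheory.Balaban1983to89.B5Composition116 (tstep_add)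
open Literature.MathematicalPhysics.QuantumFieldTheory.Balaban1983to89.B5G183RateTorus (cpt)
open Literature.MathematicalPhysics.QuantumFieldTheory.Balaban1983to89.B5G183RateTorusW (off Qavg Qavg_mul_apply)
open Summit.QuantumFields.BalabanUV.T4Continuum
open Summit.QuantumFields.BalabanUV.T4Continuum.BalabanAveragedTowerModes (val_cpt_add_off)
open Summit.QuantumFields.BalabanUV.T4Continuum.BalabanLineAverage (shiftT)
open Summit.QuantumFields.BalabanUV.T4Continuum.KingPairingPlantedLaw (JK opNorm_JK_le sqrt_facts)
open Summit.QuantumFields.BalabanUV.T4Continuum.LineAveragingPairing (glue glue_val sum_glue shiftT_mulVec lineSum_shiftT_sub cL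
  cL_eq norm_cL_le sqrt_smul_QvOp_mul_JK sum_range_shift)
open Summit.QuantumFields.BalabanUV.T4Continuum.ScalarMassTower (cpt_add_unitVec)
open Summit.QuantumFields.BalabanUV.T4Continuum.ScalarBlockTrialFunction (digits digits_bpt)
open Summit.QuantumFields.BalabanUV.T4Continuum.BalabanBlockPoincare (tileEquiv nsq_mulVec_le_rect)
open Summit.QuantumFields.BalabanUV.T4Continuum.CovariantBlockAveraging (opNorm_le_of_sq_le' opNorm_QvOp_le)
open Summit.QuantumFields.BalabanUV.T4Continuum.LineAveragingTwoLevel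

variable {d : ℕ}

section TwoLevel

variable (n L : ℕ) [NeZero n] [NeZero L] (M : Fin d → ℕ) [hM : ∀ μ, NeZero (M μ)]

/-! ## §1 Both averagings as contour sums over the same fine points -/

/-- the coarse contour of the block-averaged field, cell by cell: strided refined contours.  [folklore] -/
theorem lineSum_Qavg_mulVec (g : Tor (fine (L * n) M) × Fin d → ℂ) (x : Tor (fine n M)) (μ : Fin d) :
    lineSum n M (Qavg n L M *ᵥ g) x μ
      = ((L : ℂ) ^ d)⁻¹ * ∑ r : Fin d → Fin L, ∑ t : Fin n,
          g (cpt n L M x + off n L M (Function.update r μ 0) + tstep (fine (L * n) M) μ ((r μ : ℕ) + L * t), μ) := by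
  rw [lineSum]
  simp_rw [Qavg_mulVec]
  rw [← mul_sum, sum_comm]
  congr 1
  refine sum_congr rfl fun r _ => sum_congr rfl fun t _ => ?_
  congr 1
  conv_lhs => rw [← Function.update_eq_self μ r]
  rw [off_update, cpt_add_tstep, tstep_add]
  abel

/-- the fine contours from all points of a unit block, cell by cell. [folklore] -/
theorem sum_lineSum_fine (g : Tor (fine (L * n) M) × Fin d → ℂ) (y : Tor M) (μ : Fin d) :
    ∑ j' : Fin d → Fin (L * n), lineSum (L * n) M g (bpt (L * n) M y j') μ
      = ∑ j : Fin d → Fin n, ∑ r : Fin d → Fin L, ∑ t' : Fin (L * n),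
          g (cpt n L M (bpt n M y j) + off n L M (Function.update r μ 0) + tstep (fine (L * n) M) μ ((r μ : ℕ) + t'), μ) := by
  rw [sum_bpt_fine n L M (fun x => lineSum (L * n) M g x μ) y]
  refine sum_congr rfl fun j _ => sum_congr rfl fun r _ => ?_
  rw [lineSum]
  refine sum_congr rfl fun t' _ => ?_
  congr 1
  conv_lhs => rw [← Function.update_eq_self μ r]
  rw [off_update, tstep_add]
  abel

/-! ## §2 The identity pointwise and its size -/

/-- **THE SECOND PAIRING IDENTITY, POINTWISE**: `(Q_n·Qavg_L − Q_{Ln})g` at a unit bond `(y, μ)` is `(Ln)^{−(d+1)}·L⁻¹` times a sum,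
over the coarse cells `j` of the block, the fine offsets `r` and `σ < L`, of WINDOW SHIFTS of at most `L − 1` steps between the far end
`(y + e_μ)`-block and the near end — no tent weights, no Fourier analysis. [cite: Balaban1984PropagatorsI, (1.18) p.20; King1986, (2.10) p.653 (shapes)] [folklore] -/
theorem twoLevel_defect_apply (g : Tor (fine (L * n) M) × Fin d → ℂ) (y : Tor M) (μ : Fin d) :
    ((QvOp n M * Qavg n L M - QvOp (L * n) M) *ᵥ g) (y, μ)
      = -(1 / ((L * n : ℕ) : ℂ) ^ (d + 1) * (1 / (L : ℂ)) *
          ∑ j : Fin d → Fin n, ∑ r : Fin d → Fin L, ∑ σ : Fin L,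
            (∑ i ∈ range σ, g (cpt n L M (bpt n M y j) + off n L M (Function.update r μ 0)
                + tstep (fine (L * n) M) μ (L * n + i), μ)
              - ∑ i ∈ range σ, g (cpt n L M (bpt n M y j) + off n L M (Function.update r μ 0)
                + tstep (fine (L * n) M) μ i, μ))) := by
  have hL : (L : ℂ) ≠ 0 := by exact_mod_cast NeZero.ne L
  have hn : (n : ℂ) ≠ 0 := by exact_mod_cast NeZero.ne n
  rw [Matrix.sub_mulVec, Pi.sub_apply, ← Matrix.mulVec_mulVec, QvOp_mulVec, QvOp_mulVec, sum_lineSum_fine]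
  simp_rw [lineSum_Qavg_mulVec]
  rw [← mul_sum]
  -- per coarse cell `j`, the cancellation
  have hcell : ∀ j : Fin d → Fin n,
      (L : ℂ) * ((L : ℂ) * ∑ r : Fin d → Fin L, ∑ t : Fin n,
          g (cpt n L M (bpt n M y j) + off n L M (Function.update r μ 0) + tstep (fine (L * n) M) μ ((r μ : ℕ) + L * t), μ))
        - (L : ℂ) * ∑ r : Fin d → Fin L, ∑ t' : Fin (L * n),
          g (cpt n L M (bpt n M y j) + off n L M (Function.update r μ 0) + tstep (fine (L * n) M) μ ((r μ : ℕ) + t'), μ)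
      = -∑ r : Fin d → Fin L, ∑ σ : Fin L,
            (∑ i ∈ range σ, g (cpt n L M (bpt n M y j) + off n L M (Function.update r μ 0)
                + tstep (fine (L * n) M) μ (L * n + i), μ)
              - ∑ i ∈ range σ, g (cpt n L M (bpt n M y j) + off n L M (Function.update r μ 0)
                + tstep (fine (L * n) M) μ i, μ)) := fun j =>
    two_level_cancellation n L μ
      (G := fun r m => g (cpt n L M (bpt n M y j) + off n L M (Function.update r μ 0) + tstep (fine (L * n) M) μ m, μ))
      (fun r σ => by simp only [Function.update_idem])
  -- assemble: the prefactors `n^{−(d+1)}·L^{−d} = L·(Ln)^{−(d+1)}`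
  have key : ∀ (A B D : (Fin d → Fin n) → ℂ), (∀ j, (L : ℂ) * ((L : ℂ) * A j) - (L : ℂ) * B j = -D j) →
      1 / (n : ℂ) ^ (d + 1) * (((L : ℂ) ^ d)⁻¹ * ∑ j, A j) - 1 / ((L * n : ℕ) : ℂ) ^ (d + 1) * ∑ j, B j
        = -(1 / ((L * n : ℕ) : ℂ) ^ (d + 1) * (1 / (L : ℂ)) * ∑ j, D j) := by
    intro A B D h
    have h' : ∑ j, D j = -∑ j, ((L : ℂ) * ((L : ℂ) * A j) - (L : ℂ) * B j) := by
      rw [← sum_neg_distrib]; exact sum_congr rfl fun j _ => by rw [h j, neg_neg]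
    rw [h', sum_sub_distrib, ← mul_sum, ← mul_sum, ← mul_sum]
    push_cast
    field_simp
    ring
  exact key _ _ _ hcell

/-- the pointwise SIZE of the defect: `‖(Q_n·Qavg_L − Q_{Ln})g (y,μ)‖ ≤ L·(Ln)^{−(d+1)}·(S(y + e_μ) + S(y))`, `S(y′)` = the `ℓ¹`-mass of
`g(·, μ)` on the unit block `y′`. [folklore] -/
theorem norm_twoLevel_defect_apply_le (g : Tor (fine (L * n) M) × Fin d → ℂ) (y : Tor M) (μ : Fin d) :
    ‖((QvOp n M * Qavg n L M - QvOp (L * n) M) *ᵥ g) (y, μ)‖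
      ≤ (L : ℝ) * (((L * n : ℕ) : ℝ) ^ (d + 1))⁻¹ *
          (∑ j : Fin d → Fin n, ∑ r : Fin d → Fin L, ‖g (cpt n L M (bpt n M (y + unitVec M μ) j) + off n L M r, μ)‖
            + ∑ j : Fin d → Fin n, ∑ r : Fin d → Fin L, ‖g (cpt n L M (bpt n M y j) + off n L M r, μ)‖) := by
  have hL0 : (0 : ℝ) < L := by exact_mod_cast Nat.pos_of_ne_zero (NeZero.ne L)
  rw [twoLevel_defect_apply, norm_neg, norm_mul, norm_mul]
  have hc1 : ‖(1 / ((L * n : ℕ) : ℂ) ^ (d + 1))‖ = (((L * n : ℕ) : ℝ) ^ (d + 1))⁻¹ := by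
    rw [norm_div, norm_one, norm_pow, Complex.norm_natCast, one_div]
  have hc2 : ‖(1 / (L : ℂ))‖ = (L : ℝ)⁻¹ := by rw [norm_div, norm_one, Complex.norm_natCast, one_div]
  rw [hc1, hc2]
  -- the far and near window points are block points of the blocks `y + e_μ` and `y`
  have hfar : ∀ (j : Fin d → Fin n) (r : Fin d → Fin L) (i : Fin L),
      cpt n L M (bpt n M y j) + off n L M (Function.update r μ 0) + tstep (fine (L * n) M) μ (L * n + i)
        = cpt n L M (bpt n M (y + unitVec M μ) j) + off n L M (Function.update r μ i) := by
    intro j r i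
    rw [← bpt_add_tstep, cpt_add_tstep, off_update n L M r μ i, tstep_add]
    abel
  have hnear : ∀ (j : Fin d → Fin n) (r : Fin d → Fin L) (i : Fin L),
      cpt n L M (bpt n M y j) + off n L M (Function.update r μ 0) + tstep (fine (L * n) M) μ i
        = cpt n L M (bpt n M y j) + off n L M (Function.update r μ i) := by
    intro j r i
    rw [off_update n L M r μ i, add_assoc]
  -- bound the window sums by full `L`-windows
  have hwin : ∀ (j : Fin d → Fin n) (r : Fin d → Fin L) (σ : Fin L),
      ‖∑ i ∈ range σ, g (cpt n L M (bpt n M y j) + off n L M (Function.update r μ 0) + tstep (fine (L * n) M) μ (L * n + i), μ)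
          - ∑ i ∈ range σ, g (cpt n L M (bpt n M y j) + off n L M (Function.update r μ 0) + tstep (fine (L * n) M) μ i, μ)‖
        ≤ ∑ i : Fin L, ‖g (cpt n L M (bpt n M (y + unitVec M μ) j) + off n L M (Function.update r μ i), μ)‖
          + ∑ i : Fin L, ‖g (cpt n L M (bpt n M y j) + off n L M (Function.update r μ i), μ)‖ := by
    intro j r σ
    set F₁ : ℕ → ℝ := fun i => ‖g (cpt n L M (bpt n M y j) + off n L M (Function.update r μ 0)
        + tstep (fine (L * n) M) μ (L * n + i), μ)‖ with hF₁
    set F₂ : ℕ → ℝ := fun i => ‖g (cpt n L M (bpt n M y j) + off n L M (Function.update r μ 0)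
        + tstep (fine (L * n) M) μ i, μ)‖ with hF₂
    refine (norm_sub_le _ _).trans (add_le_add ?_ ?_)
    · refine (norm_sum_le _ _).trans ?_
      calc ∑ i ∈ range (σ : ℕ), F₁ i ≤ ∑ i ∈ range L, F₁ i :=
            sum_le_sum_of_subset_of_nonneg (range_subset_range.mpr σ.isLt.le) fun _ _ _ => norm_nonneg _
        _ = ∑ i : Fin L, F₁ i := (Fin.sum_univ_eq_sum_range F₁ L).symm
        _ = _ := sum_congr rfl fun i _ => by rw [hF₁]; dsimp only; rw [hfar]
    · refine (norm_sum_le _ _).trans ?_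
      calc ∑ i ∈ range (σ : ℕ), F₂ i ≤ ∑ i ∈ range L, F₂ i :=
            sum_le_sum_of_subset_of_nonneg (range_subset_range.mpr σ.isLt.le) fun _ _ _ => norm_nonneg _
        _ = ∑ i : Fin L, F₂ i := (Fin.sum_univ_eq_sum_range F₂ L).symm
        _ = _ := sum_congr rfl fun i _ => by rw [hF₂]; dsimp only; rw [hnear]
  -- sum over `σ` (constant) and over the fibres of the update
  have hsum : ‖∑ j : Fin d → Fin n, ∑ r : Fin d → Fin L, ∑ σ : Fin L,
        (∑ i ∈ range σ, g (cpt n L M (bpt n M y j) + off n L M (Function.update r μ 0) + tstep (fine (L * n) M) μ (L * n + i), μ)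
          - ∑ i ∈ range σ, g (cpt n L M (bpt n M y j) + off n L M (Function.update r μ 0) + tstep (fine (L * n) M) μ i, μ))‖
      ≤ (L : ℝ) * ((L : ℝ) *
          (∑ j : Fin d → Fin n, ∑ r : Fin d → Fin L, ‖g (cpt n L M (bpt n M (y + unitVec M μ) j) + off n L M r, μ)‖
            + ∑ j : Fin d → Fin n, ∑ r : Fin d → Fin L, ‖g (cpt n L M (bpt n M y j) + off n L M r, μ)‖)) := by
    refine (norm_sum_le _ _).trans ?_
    refine (sum_le_sum fun j _ => (norm_sum_le _ _).trans (sum_le_sum fun r _ =>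
      (norm_sum_le _ _).trans (sum_le_sum fun σ _ => hwin j r σ))).trans (le_of_eq ?_)
    simp only [sum_const, card_univ, Fintype.card_fin, nsmul_eq_mul]
    have h1 : ∀ j : Fin d → Fin n,
        ∑ r : Fin d → Fin L, (∑ i : Fin L, ‖g (cpt n L M (bpt n M (y + unitVec M μ) j) + off n L M (Function.update r μ i), μ)‖
          + ∑ i : Fin L, ‖g (cpt n L M (bpt n M y j) + off n L M (Function.update r μ i), μ)‖)
          = (L : ℝ) * (∑ r : Fin d → Fin L, ‖g (cpt n L M (bpt n M (y + unitVec M μ) j) + off n L M r, μ)‖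
            + ∑ r : Fin d → Fin L, ‖g (cpt n L M (bpt n M y j) + off n L M r, μ)‖) := by
      intro j
      rw [sum_add_distrib, sum_sum_update L μ (fun r => ‖g (cpt n L M (bpt n M (y + unitVec M μ) j) + off n L M r, μ)‖),
        sum_sum_update L μ (fun r => ‖g (cpt n L M (bpt n M y j) + off n L M r, μ)‖), nsmul_eq_mul, nsmul_eq_mul, mul_add]
    simp_rw [← mul_sum]
    simp_rw [h1]
    rw [← mul_sum, sum_add_distrib]
  have h0 : 0 ≤ (((L * n : ℕ) : ℝ) ^ (d + 1))⁻¹ := by positivity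
  calc (((L * n : ℕ) : ℝ) ^ (d + 1))⁻¹ * (L : ℝ)⁻¹ * ‖∑ j : Fin d → Fin n, ∑ r : Fin d → Fin L, ∑ σ : Fin L,
        (∑ i ∈ range σ, g (cpt n L M (bpt n M y j) + off n L M (Function.update r μ 0) + tstep (fine (L * n) M) μ (L * n + i), μ)
          - ∑ i ∈ range σ, g (cpt n L M (bpt n M y j) + off n L M (Function.update r μ 0) + tstep (fine (L * n) M) μ i, μ))‖
      ≤ (((L * n : ℕ) : ℝ) ^ (d + 1))⁻¹ * (L : ℝ)⁻¹ * ((L : ℝ) * ((L : ℝ) *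
          (∑ j : Fin d → Fin n, ∑ r : Fin d → Fin L, ‖g (cpt n L M (bpt n M (y + unitVec M μ) j) + off n L M r, μ)‖
            + ∑ j : Fin d → Fin n, ∑ r : Fin d → Fin L, ‖g (cpt n L M (bpt n M y j) + off n L M r, μ)‖))) :=
        mul_le_mul_of_nonneg_left hsum (by positivity)
    _ = _ := by field_simp

/-! ## §3 The operator-norm bound -/

/-- **`Q_n·Qavg_L = Q_{Ln} + D_E` WITH `‖D_E‖ ≤ 2·n⁻¹·(Ln)^{−d/2}`**: Bałaban's `n`-fold (1.18) average of King's `L`-block means is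
the `(Ln)`-fold (1.18) average up to an OPERATOR-NORM defect of relative size `n⁻¹` — the (1.18) tent is Lipschitz at the scale of the
`L`-blocks.  No regularity of the field is used.  (Companion of `LineAveragingPairing.sqrt_smul_QvOp_mul_JK`, the identity for
`Q_{Ln}·J_L`; statement and proof OURS.) [cite: Balaban1984PropagatorsI, (1.18) p.20; King1986, (2.10) p.653 (shapes)] [folklore] -/
theorem opNorm_QvOp_mul_Qavg_sub_le :
    ‖QvOp n M * Qavg n L M - QvOp (L * n) M‖ ≤ 2 * ((n : ℝ))⁻¹ * (Real.sqrt (((L * n : ℕ) : ℝ) ^ d))⁻¹ := by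
  have hn : (0 : ℝ) < n := by exact_mod_cast Nat.pos_of_ne_zero (NeZero.ne n)
  have hL : (0 : ℝ) < L := by exact_mod_cast Nat.pos_of_ne_zero (NeZero.ne L)
  have hLn : (0 : ℝ) < ((L * n : ℕ) : ℝ) := by push_cast; positivity
  have hLnd : (0 : ℝ) < (((L * n : ℕ) : ℝ)) ^ d := pow_pos hLn d
  set X := QvOp n M * Qavg n L M - QvOp (L * n) M with hX
  refine opNorm_le_of_sq_le' X (by positivity) fun g => ?_
  have e0 : ∑ b, ‖∑ i, X b i * g i‖ ^ 2 = ∑ b, ‖(X *ᵥ g) b‖ ^ 2 := rfl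
  rw [e0, Fintype.sum_prod_type]
  -- names: the block masses
  set c : ℝ := (L : ℝ) * (((L * n : ℕ) : ℝ) ^ (d + 1))⁻¹ with hc
  have hN2 : ∀ (y : Tor M) (μ : Fin d),
      (∑ j : Fin d → Fin n, ∑ r : Fin d → Fin L, ‖g (cpt n L M (bpt n M y j) + off n L M r, μ)‖) ^ 2
        ≤ (((L * n : ℕ) : ℝ)) ^ d * ∑ j : Fin d → Fin n, ∑ r : Fin d → Fin L, ‖g (cpt n L M (bpt n M y j) + off n L M r, μ)‖ ^ 2 := by
    intro y μ
    have h1 : (∑ j : Fin d → Fin n, ∑ r : Fin d → Fin L, ‖g (cpt n L M (bpt n M y j) + off n L M r, μ)‖) ^ 2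
        ≤ (n : ℝ) ^ d * ∑ j : Fin d → Fin n, (∑ r : Fin d → Fin L, ‖g (cpt n L M (bpt n M y j) + off n L M r, μ)‖) ^ 2 := by
      have := sq_sum_le_card_mul_sum_sq (s := (univ : Finset (Fin d → Fin n)))
        (f := fun j => ∑ r : Fin d → Fin L, ‖g (cpt n L M (bpt n M y j) + off n L M r, μ)‖)
      simp only [card_univ, Fintype.card_fun, Fintype.card_fin] at this
      push_cast at this
      exact this
    have h2 : ∀ j : Fin d → Fin n, (∑ r : Fin d → Fin L, ‖g (cpt n L M (bpt n M y j) + off n L M r, μ)‖) ^ 2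
        ≤ (L : ℝ) ^ d * ∑ r : Fin d → Fin L, ‖g (cpt n L M (bpt n M y j) + off n L M r, μ)‖ ^ 2 := by
      intro j
      have := sq_sum_le_card_mul_sum_sq (s := (univ : Finset (Fin d → Fin L)))
        (f := fun r => ‖g (cpt n L M (bpt n M y j) + off n L M r, μ)‖)
      simp only [card_univ, Fintype.card_fun, Fintype.card_fin] at this
      push_cast at this
      exact this
    refine h1.trans ?_
    have h3 : (n : ℝ) ^ d * ∑ j : Fin d → Fin n, (∑ r : Fin d → Fin L, ‖g (cpt n L M (bpt n M y j) + off n L M r, μ)‖) ^ 2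
        ≤ (n : ℝ) ^ d * ∑ j : Fin d → Fin n, ((L : ℝ) ^ d * ∑ r : Fin d → Fin L, ‖g (cpt n L M (bpt n M y j) + off n L M r, μ)‖ ^ 2) :=
      mul_le_mul_of_nonneg_left (sum_le_sum fun j _ => h2 j) (by positivity)
    refine h3.trans (le_of_eq ?_)
    rw [← mul_sum, ← mul_assoc, ← mul_pow]
    push_cast
    ring
  have hterm : ∀ (y : Tor M) (μ : Fin d), ‖(X *ᵥ g) (y, μ)‖ ^ 2
      ≤ c ^ 2 * (2 * ((((L * n : ℕ) : ℝ)) ^ d *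
          (∑ j : Fin d → Fin n, ∑ r : Fin d → Fin L, ‖g (cpt n L M (bpt n M (y + unitVec M μ) j) + off n L M r, μ)‖ ^ 2
            + ∑ j : Fin d → Fin n, ∑ r : Fin d → Fin L, ‖g (cpt n L M (bpt n M y j) + off n L M r, μ)‖ ^ 2))) := by
    intro y μ
    have h := norm_twoLevel_defect_apply_le n L M g y μ
    rw [← hX, ← hc] at h
    have hc0 : 0 ≤ c := by rw [hc]; positivity
    set S₁ := ∑ j : Fin d → Fin n, ∑ r : Fin d → Fin L, ‖g (cpt n L M (bpt n M (y + unitVec M μ) j) + off n L M r, μ)‖ with hS₁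
    set S₂ := ∑ j : Fin d → Fin n, ∑ r : Fin d → Fin L, ‖g (cpt n L M (bpt n M y j) + off n L M r, μ)‖ with hS₂
    have hsq : ‖(X *ᵥ g) (y, μ)‖ ^ 2 ≤ (c * (S₁ + S₂)) ^ 2 := pow_le_pow_left₀ (norm_nonneg _) h 2
    refine hsq.trans ?_
    rw [mul_pow]
    refine mul_le_mul_of_nonneg_left ?_ (sq_nonneg _)
    have h12 : (S₁ + S₂) ^ 2 ≤ 2 * (S₁ ^ 2 + S₂ ^ 2) := by nlinarith [sq_nonneg (S₁ - S₂)]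
    refine h12.trans ?_
    rw [mul_add (((L * n : ℕ) : ℝ) ^ d)]
    exact mul_le_mul_of_nonneg_left (add_le_add (hN2 (y + unitVec M μ) μ) (hN2 y μ)) (by norm_num)
  refine (sum_le_sum fun y _ => sum_le_sum fun μ _ => hterm y μ).trans ?_
  -- the block masses sum to `‖g‖²`
  have hSB : ∑ y : Tor M, ∑ μ : Fin d, ∑ j : Fin d → Fin n, ∑ r : Fin d → Fin L, ‖g (cpt n L M (bpt n M y j) + off n L M r, μ)‖ ^ 2
      = ∑ i, ‖g i‖ ^ 2 := by
    calc ∑ y : Tor M, ∑ μ : Fin d, ∑ j : Fin d → Fin n, ∑ r : Fin d → Fin L, ‖g (cpt n L M (bpt n M y j) + off n L M r, μ)‖ ^ 2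
        = ∑ μ : Fin d, ∑ y : Tor M, ∑ j : Fin d → Fin n, ∑ r : Fin d → Fin L, ‖g (cpt n L M (bpt n M y j) + off n L M r, μ)‖ ^ 2 :=
          sum_comm
      _ = ∑ μ : Fin d, ∑ x' : Tor (fine (L * n) M), ‖g (x', μ)‖ ^ 2 := by
          refine sum_congr rfl fun μ _ => ?_
          rw [← sum_blocks' n M (fun x => ∑ r : Fin d → Fin L, ‖g (cpt n L M x + off n L M r, μ)‖ ^ 2),
            ← sum_tile' n L M (fun x' => ‖g (x', μ)‖ ^ 2)]
      _ = ∑ x' : Tor (fine (L * n) M), ∑ μ : Fin d, ‖g (x', μ)‖ ^ 2 := sum_comm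
      _ = ∑ i, ‖g i‖ ^ 2 := by rw [Fintype.sum_prod_type]
  have hSA : ∑ y : Tor M, ∑ μ : Fin d, ∑ j : Fin d → Fin n, ∑ r : Fin d → Fin L,
        ‖g (cpt n L M (bpt n M (y + unitVec M μ) j) + off n L M r, μ)‖ ^ 2 = ∑ i, ‖g i‖ ^ 2 := by
    rw [← hSB, sum_comm]
    conv_rhs => rw [sum_comm]
    refine sum_congr rfl fun μ _ => ?_
    exact Fintype.sum_equiv (Equiv.addRight (unitVec M μ)) _ _ fun y => rfl
  have htot : ∑ y : Tor M, ∑ μ : Fin d, c ^ 2 * (2 * ((((L * n : ℕ) : ℝ)) ^ d *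
          (∑ j : Fin d → Fin n, ∑ r : Fin d → Fin L, ‖g (cpt n L M (bpt n M (y + unitVec M μ) j) + off n L M r, μ)‖ ^ 2
            + ∑ j : Fin d → Fin n, ∑ r : Fin d → Fin L, ‖g (cpt n L M (bpt n M y j) + off n L M r, μ)‖ ^ 2)))
      = c ^ 2 * (2 * ((((L * n : ℕ) : ℝ)) ^ d * (∑ i, ‖g i‖ ^ 2 + ∑ i, ‖g i‖ ^ 2))) := by
    simp_rw [← mul_sum]
    simp_rw [sum_add_distrib]
    rw [hSA, hSB]
  rw [htot, hc, mul_pow, mul_pow, inv_pow (Real.sqrt _), Real.sq_sqrt hLnd.le]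
  have hn0 : (n : ℝ) ≠ 0 := hn.ne'
  have hL0 : (L : ℝ) ≠ 0 := hL.ne'
  apply le_of_eq
  push_cast
  field_simp
  ring

end TwoLevel

end Summit.QuantumFields.BalabanUV.T4Continuum.LineAveragingTwoLevelPairing

end
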